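import Summits.HodgeConjecture.CorCM.MultiFieldWeilBlockGluing
import Summits.HodgeConjecture.CorCM.MultiFieldWeilAnyTwoSimpleDimLeThree
import HarnessLib

/-!
# MULTI-FIELD WEIL ENGINE — ANY TWO SIMPLE CM ABELIAN VARIETIES OF DIMENSION `≤ 3` AND A FOREIGN CM ELLIPTIC CURVE: the Hodge conjecture for every
# `A₀^a × A₁^b × E′^c`, given ONLY Markman's fourfold theorem (first consumer of the block-gluing theorem)

Cell `pub-hodgecm2` (COR-CM), seat b30 gen 31 (2026-08-24); count-neutral own lane MULTI-FIELD WEIL ENGINE (stem `MultiFieldWeil*`), sequel of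
`CorCM/MultiFieldWeilBlockGluing.lean` (G8) and `CorCM/MultiFieldWeilAnyTwoSimpleDimLeThree.lean` (G7).  Theorems only; no definition, no named fact, no `sorry`.
HONEST FRAMING: conditional on the displayed Markman fourfold binder only; `HC_CM` is NOT proved and not asserted.

THE STATEMENT (**`hodgeConjectureFor_biproduct_comp_vec_of_two_simple_dim_le_three_foreignCurve_of_markman`**).  `A₀ ⊨ (K₀; Φ₀)`, `A₁ ⊨ (K₁; Φ₁)` SIMPLE CM
abelian varieties of dimension `≤ 3`, `E′ ⊨ (k′; Ψ′)` a CM elliptic curve whose imaginary quadratic field is FOREIGN to the pair: the Galois closure of `k′` in `ℂ` meets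
the compositum `L(K₀) · L(K₁)` of the Galois closures in `ℚ` (i.e. `k′ ⊄ L(K₀) L(K₁)`).  Then for every `κ : Fin N → Fin 3` the Hodge conjecture holds for
`⨁_j ![A₀, A₁, E′] (κ j)` — every `A₀^a × A₁^b × E′^c` — GIVEN ONLY `Markman2025_weilClasses_algebraic_abelianFourfold`.  Blocks: `{E′}` (powers of a CM curve,
unconditional by stable nondegeneracy in dimension `≤ 3`) and `{A₀, A₁}` (G7, modulo Markman), glued along the partial conjugation of `k′`
(`hodgeConjectureFor_prod_of_blocks_of_inf_eq_bot`).  When `k′` lies in `L(K₀) L(K₁)` (e.g. embeds in a sextic `K_i`) this file says nothing (see G4 for the `k`-curve of a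
pair of threefolds).

[cite: Markman2025SurveySecant, Thm. 1.2] [cite: MoonenZarhin1999LowDim, Thm. (0.1), §5 (5.2)] [cite: Gordon1999HodgeAVSurvey, §3 Theorem (proof), 7.5–7.7]
[cite: Pohlmann1968, Thm 1] [cite: Lang2002, VI §1 Thm. 1.14]

## References
* [Markman2025SurveySecant] E. Markman, arXiv:2509.23403, Thm. 1.2.  [MoonenZarhin1999LowDim] B. Moonen, Yu. Zarhin, Math. Ann. 315 (1999).
  [Gordon1999HodgeAVSurvey] B. B. Gordon, *A survey of the Hodge conjecture for abelian varieties*, §3, 7.5–7.7.  [Pohlmann1968] Ann. of Math. 88, Thm 1.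
  [Lang2002] S. Lang, *Algebra*, VI §1 Thm. 1.14.
-/

noncomputable section

open CategoryTheory CategoryTheory.Limits NumberField IntermediateField

namespace Summit.HodgeConjecture.CorCM.MultiFieldWeil

open Literature.AlgebraicGeometry Literature.AlgebraicGeometry.Motives Literature.AlgebraicGeometry.HodgeTheory
open Literature.AlgebraicGeometry.ComplexMultiplication (IsCMTypeRealisation)
open Literature.AlgebraicTopology.SingularHomology
open Literature.NumberTheory.ComplexMultiplication
open Literature.AlgebraicGeometry.Milne1999 (IsOfCMType)

open scoped Classical

section Foreign

variable {K₀ K₁ k' : Type} [Field K₀] [NumberField K₀] [IsCMField K₀] [Field K₁] [NumberField K₁] [IsCMField K₁] [Field k'] [NumberField k'] [IsCMField k']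
  {N : ℕ} {T₀ T₁ E' : AbelianVariety ℂ} {Φ₀ : CMType K₀} {Φ₁ : CMType K₁} {Ψ' : CMType k'}
  {ι₀ : 𝓞 K₀ →+* End T₀} {θ₀ : K₀ →+* Module.End ℂ (complexBetti T₀.X 1)}
  {ι₁ : 𝓞 K₁ →+* End T₁} {θ₁ : K₁ →+* Module.End ℂ (complexBetti T₁.X 1)}
  {ιE : 𝓞 k' →+* End E'} {θE : k' →+* Module.End ℂ (complexBetti E'.X 1)}

omit [IsCMField k'] in
/-- **Every product of copies of ONE CM elliptic curve satisfies the Hodge conjecture** (an isogeny factor of a power; stable nondegeneracy in dimension `≤ 3`, b16).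
[cite: MoonenZarhin1999LowDim, §5 (5.2)] [cite: Gordon1999HodgeAVSurvey, 7.6.1] -/
theorem hodgeConjectureFor_biproduct_const_cmCurve (h2 : Module.finrank ℚ k' = 2) (hE : IsCMTypeRealisation Ψ' E' ιE θE) (M : ℕ) :
    HodgeConjectureFor (⨁ fun _ : Fin M => E').dim (⨁ fun _ : Fin M => E').X := by
  have hcm : IsOfCMType E' := isOfCMType_of_isCMTypeRealisation hE
  have hdim : E'.dim ≤ 3 := by rw [AndreProductForm.dim_eq_of_isCMTypeRealisation hE, h2]; norm_num
  obtain ⟨L, hdom⟩ := exists_avDominatedBy_biproduct_slots_powSucc (A' := fun _ : Unit => E') (cls := fun _ : Fin 1 => ()) (X := E')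
    (fun u => ⟨0, by cases u; rfl⟩) (Literature.AlgebraicGeometry.Pohlmann1968.isIsogenous_powSucc_biproduct E' 0) (fun _ : Fin M => ())
  exact hodgeConjectureFor_of_avDominatedBy_powSucc_of_isOfCMType_of_dim_le_three hcm hdim hdom

/-- **ANY TWO SIMPLE CM ABELIAN VARIETIES OF DIMENSION `≤ 3` AND A FOREIGN CM ELLIPTIC CURVE, given ONLY Markman's fourfold theorem.**  `A₀`, `A₁` simple, of CM type,
`dim ≤ 3`; `E′` a CM elliptic curve with `L(k′) ∩ (L(K₀) ⊔ L(K₁)) = ℚ` (`L = normalClosure ℚ · ℂ`).  Then the Hodge conjecture holds for `⨁_j ![A₀, A₁, E′] (κ j)` for every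
`κ` — every `A₀^a × A₁^b × E′^c` —, the blocks `{E′}` (unconditional) and `{A₀, A₁}` (G7) glued along the partial conjugation of `k′` (G8).  `HC_CM` is NOT asserted.
[cite: Markman2025SurveySecant, Thm. 1.2] [cite: Gordon1999HodgeAVSurvey, §3 Theorem (proof)] [cite: Pohlmann1968, Thm 1] [cite: Lang2002, VI §1 Thm. 1.14] -/
theorem hodgeConjectureFor_biproduct_comp_vec_of_two_simple_dim_le_three_foreignCurve_of_markman (hW4 : Markman2025_weilClasses_algebraic_abelianFourfold)
    (h2 : Module.finrank ℚ k' = 2) (hA₀ : IsCMTypeRealisation Φ₀ T₀ ι₀ θ₀) (hA₁ : IsCMTypeRealisation Φ₁ T₁ ι₁ θ₁) (hE : IsCMTypeRealisation Ψ' E' ιE θE)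
    (hS₀ : T₀.IsSimple) (hS₁ : T₁.IsSimple) (h3₀ : T₀.dim ≤ 3) (h3₁ : T₁.dim ≤ 3)
    (hfor : normalClosure ℚ k' ℂ ⊓ (normalClosure ℚ K₀ ℂ ⊔ normalClosure ℚ K₁ ℂ) = ⊥) (κ : Fin N → Fin 3) :
    HodgeConjectureFor (⨁ fun j => (![T₀, T₁, E'] : Fin 3 → AbelianVariety ℂ) (κ j)).dim (⨁ fun j => (![T₀, T₁, E'] : Fin 3 → AbelianVariety ℂ) (κ j)).X := by
  -- the family `(K₀, K₁, k′)` over `Fin 3`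
  let K : Fin 3 → Type := Fin.cons K₀ (Fin.cons K₁ (Fin.cons k' finZeroElim))
  letI instF : ∀ j, Field (K j) := Fin.cons ‹Field K₀› (Fin.cons ‹Field K₁› (Fin.cons ‹Field k'› finZeroElim))
  letI instN : ∀ j, NumberField (K j) := Fin.cons ‹NumberField K₀› (Fin.cons ‹NumberField K₁› (Fin.cons ‹NumberField k'› finZeroElim))
  haveI instC : ∀ j, IsCMField (K j) := Fin.cons ‹IsCMField K₀› (Fin.cons ‹IsCMField K₁› (Fin.cons ‹IsCMField k'› finZeroElim))
  let Φ : ∀ j : Fin 3, CMType (K j) := Fin.cons Φ₀ (Fin.cons Φ₁ (Fin.cons Ψ' finZeroElim))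
  let ι : ∀ j : Fin 3, 𝓞 (K j) →+* End ((![T₀, T₁, E'] : Fin 3 → AbelianVariety ℂ) j) := Fin.cons ι₀ (Fin.cons ι₁ (Fin.cons ιE finZeroElim))
  let θ : ∀ j : Fin 3, K j →+* Module.End ℂ (complexBetti ((![T₀, T₁, E'] : Fin 3 → AbelianVariety ℂ) j).X 1) :=
    Fin.cons θ₀ (Fin.cons θ₁ (Fin.cons θE finZeroElim))
  have hA : ∀ j, IsCMTypeRealisation (Φ j) ((![T₀, T₁, E'] : Fin 3 → AbelianVariety ℂ) j) (ι j) (θ j) :=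
    Fin.cons hA₀ (Fin.cons hA₁ (Fin.cons hE finZeroElim))
  refine hodgeConjectureFor_prod_of_blocks_of_inf_eq_bot (K := K) (A := (![T₀, T₁, E'] : Fin 3 → AbelianVariety ℂ)) (Φ := Φ) (ι := ι) (θ := θ)
    hA (fun j => j = 2) ?_ ?_ ?_ κ
  · -- the two composita are inside `L(k′)` and `L(K₀) ⊔ L(K₁)`
    refine le_bot_iff.1 (le_trans (inf_le_inf (iSup_le fun i => ?_) (iSup_le fun i => ?_)) hfor.le)
    · obtain ⟨i, rfl⟩ := i
      exact le_rfl
    · obtain ⟨i, hi⟩ := i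
      fin_cases i
      · exact le_sup_left
      · exact le_sup_right
      · exact absurd rfl hi
  · -- block `{E′}`: products of copies of one CM curve
    intro M ρ hρ
    have hfun : (fun l => (![T₀, T₁, E'] : Fin 3 → AbelianVariety ℂ) (ρ l)) = fun _ => E' := funext fun l => by rw [hρ l]; rfl
    rw [hfun]
    exact hodgeConjectureFor_biproduct_const_cmCurve h2 hE M
  · -- block `{A₀, A₁}`: G7
    intro M ρ hρ
    have hlt : ∀ l, (ρ l : ℕ) < 2 := fun l => by
      have h := (ρ l).isLt
      have h2' : (ρ l : ℕ) ≠ 2 := fun h' => hρ l (Fin.ext h')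
      omega
    let κ' : Fin M → Fin 2 := fun l => ⟨ρ l, hlt l⟩
    have hfun : (fun l => (![T₀, T₁, E'] : Fin 3 → AbelianVariety ℂ) (ρ l)) = fun l => (![T₀, T₁] : Fin 2 → AbelianVariety ℂ) (κ' l) := by
      funext l
      have hc : ρ l = Fin.castSucc (κ' l) := Fin.ext rfl
      rw [hc]
      generalize κ' l = c
      fin_cases c <;> rfl
    rw [hfun]
    exact hodgeConjectureFor_biproduct_comp_vec_of_any_two_simple_dim_le_three_of_markman hW4 hA₀ hA₁ hS₀ hS₁ h3₀ h3₁ κ'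

omit [IsCMField k'] in
/-- **Every product of copies of ONE CM abelian variety of dimension `≤ 3` satisfies the Hodge conjecture** (an isogeny factor of a power; b16's census,
Moonen–Zarhin (5.2)). [cite: MoonenZarhin1999LowDim, §5 (5.2)] [cite: Gordon1999HodgeAVSurvey, 7.5 and 7.6.1] -/
theorem hodgeConjectureFor_biproduct_const_of_dim_le_three (hE : IsCMTypeRealisation Ψ' E' ιE θE) (h3 : E'.dim ≤ 3) (M : ℕ) :
    HodgeConjectureFor (⨁ fun _ : Fin M => E').dim (⨁ fun _ : Fin M => E').X := by
  have hcm : IsOfCMType E' := isOfCMType_of_isCMTypeRealisation hE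
  obtain ⟨L, hdom⟩ := exists_avDominatedBy_biproduct_slots_powSucc (A' := fun _ : Unit => E') (cls := fun _ : Fin 1 => ()) (X := E')
    (fun u => ⟨0, by cases u; rfl⟩) (Literature.AlgebraicGeometry.Pohlmann1968.isIsogenous_powSucc_biproduct E' 0) (fun _ : Fin M => ())
  exact hodgeConjectureFor_of_avDominatedBy_powSucc_of_isOfCMType_of_dim_le_three hcm h3 hdom

/-- **GENERAL THIRD FACTOR: any two simple CM abelian varieties of dimension `≤ 3` AND ANY FOREIGN CM abelian variety `E′ ⊨ (k′; Ψ′)` of dimension `≤ 3`**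
(simple or not: a CM curve, surface or threefold with `L(k′) ∩ (L(K₀) ⊔ L(K₁)) = ℚ`), given ONLY Markman's fourfold theorem: the Hodge conjecture for every
`⨁_j ![A₀, A₁, E′] (κ j)`.  Blocks `{E′}` (powers, unconditional) and `{A₀, A₁}` (G7), glued by G8. [cite: Markman2025SurveySecant, Thm. 1.2]
[cite: Gordon1999HodgeAVSurvey, §3 Theorem (proof)] [cite: Pohlmann1968, Thm 1] [cite: Lang2002, VI §1 Thm. 1.14] -/
theorem hodgeConjectureFor_biproduct_comp_vec_of_two_simple_dim_le_three_foreign_third_of_markman (hW4 : Markman2025_weilClasses_algebraic_abelianFourfold)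
    (hA₀ : IsCMTypeRealisation Φ₀ T₀ ι₀ θ₀) (hA₁ : IsCMTypeRealisation Φ₁ T₁ ι₁ θ₁) (hE : IsCMTypeRealisation Ψ' E' ιE θE)
    (hS₀ : T₀.IsSimple) (hS₁ : T₁.IsSimple) (h3₀ : T₀.dim ≤ 3) (h3₁ : T₁.dim ≤ 3) (h3 : E'.dim ≤ 3)
    (hfor : normalClosure ℚ k' ℂ ⊓ (normalClosure ℚ K₀ ℂ ⊔ normalClosure ℚ K₁ ℂ) = ⊥) (κ : Fin N → Fin 3) :
    HodgeConjectureFor (⨁ fun j => (![T₀, T₁, E'] : Fin 3 → AbelianVariety ℂ) (κ j)).dim (⨁ fun j => (![T₀, T₁, E'] : Fin 3 → AbelianVariety ℂ) (κ j)).X := by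
  -- the family `(K₀, K₁, k′)` over `Fin 3`
  let K : Fin 3 → Type := Fin.cons K₀ (Fin.cons K₁ (Fin.cons k' finZeroElim))
  letI instF : ∀ j, Field (K j) := Fin.cons ‹Field K₀› (Fin.cons ‹Field K₁› (Fin.cons ‹Field k'› finZeroElim))
  letI instN : ∀ j, NumberField (K j) := Fin.cons ‹NumberField K₀› (Fin.cons ‹NumberField K₁› (Fin.cons ‹NumberField k'› finZeroElim))
  haveI instC : ∀ j, IsCMField (K j) := Fin.cons ‹IsCMField K₀› (Fin.cons ‹IsCMField K₁› (Fin.cons ‹IsCMField k'› finZeroElim))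
  let Φ : ∀ j : Fin 3, CMType (K j) := Fin.cons Φ₀ (Fin.cons Φ₁ (Fin.cons Ψ' finZeroElim))
  let ι : ∀ j : Fin 3, 𝓞 (K j) →+* End ((![T₀, T₁, E'] : Fin 3 → AbelianVariety ℂ) j) := Fin.cons ι₀ (Fin.cons ι₁ (Fin.cons ιE finZeroElim))
  let θ : ∀ j : Fin 3, K j →+* Module.End ℂ (complexBetti ((![T₀, T₁, E'] : Fin 3 → AbelianVariety ℂ) j).X 1) :=
    Fin.cons θ₀ (Fin.cons θ₁ (Fin.cons θE finZeroElim))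
  have hA : ∀ j, IsCMTypeRealisation (Φ j) ((![T₀, T₁, E'] : Fin 3 → AbelianVariety ℂ) j) (ι j) (θ j) :=
    Fin.cons hA₀ (Fin.cons hA₁ (Fin.cons hE finZeroElim))
  refine hodgeConjectureFor_prod_of_blocks_of_inf_eq_bot (K := K) (A := (![T₀, T₁, E'] : Fin 3 → AbelianVariety ℂ)) (Φ := Φ) (ι := ι) (θ := θ)
    hA (fun j => j = 2) ?_ ?_ ?_ κ
  · -- the two composita are inside `L(k′)` and `L(K₀) ⊔ L(K₁)`
    refine le_bot_iff.1 (le_trans (inf_le_inf (iSup_le fun i => ?_) (iSup_le fun i => ?_)) hfor.le)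
    · obtain ⟨i, rfl⟩ := i
      exact le_rfl
    · obtain ⟨i, hi⟩ := i
      fin_cases i
      · exact le_sup_left
      · exact le_sup_right
      · exact absurd rfl hi
  · -- block `{E′}`: powers of one CM abelian variety of dimension `≤ 3`
    intro M ρ hρ
    have hfun : (fun l => (![T₀, T₁, E'] : Fin 3 → AbelianVariety ℂ) (ρ l)) = fun _ => E' := funext fun l => by rw [hρ l]; rfl
    rw [hfun]
    exact hodgeConjectureFor_biproduct_const_of_dim_le_three hE h3 M
  · -- block `{A₀, A₁}`: G7
    intro M ρ hρ
    have hlt : ∀ l, (ρ l : ℕ) < 2 := fun l => by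
      have h := (ρ l).isLt
      have h2' : (ρ l : ℕ) ≠ 2 := fun h' => hρ l (Fin.ext h')
      omega
    let κ' : Fin M → Fin 2 := fun l => ⟨ρ l, hlt l⟩
    have hfun : (fun l => (![T₀, T₁, E'] : Fin 3 → AbelianVariety ℂ) (ρ l)) = fun l => (![T₀, T₁] : Fin 2 → AbelianVariety ℂ) (κ' l) := by
      funext l
      have hc : ρ l = Fin.castSucc (κ' l) := Fin.ext rfl
      rw [hc]
      generalize κ' l = c
      fin_cases c <;> rfl
    rw [hfun]
    exact hodgeConjectureFor_biproduct_comp_vec_of_any_two_simple_dim_le_three_of_markman hW4 hA₀ hA₁ hS₀ hS₁ h3₀ h3₁ κ'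

/-- **In particular two simple CM THREEFOLDS and a foreign CM elliptic curve** (the case where both blocks are degenerate at once: `T₀ × T₁` may carry the
`k`-Weil classes and `E′` is glued on). [cite: Markman2025SurveySecant, Thm. 1.2] [cite: Gordon1999HodgeAVSurvey, §3 Theorem (proof)] -/
theorem hodgeConjectureFor_biproduct_comp_vec_of_two_simpleThreefolds_foreignCurve_of_markman (hW4 : Markman2025_weilClasses_algebraic_abelianFourfold)
    (h6₀ : Module.finrank ℚ K₀ = 6) (h6₁ : Module.finrank ℚ K₁ = 6) (h2 : Module.finrank ℚ k' = 2)
    (hT₀ : IsCMTypeRealisation Φ₀ T₀ ι₀ θ₀) (hT₁ : IsCMTypeRealisation Φ₁ T₁ ι₁ θ₁) (hE : IsCMTypeRealisation Ψ' E' ιE θE)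
    (hS₀ : T₀.IsSimple) (hS₁ : T₁.IsSimple)
    (hfor : normalClosure ℚ k' ℂ ⊓ (normalClosure ℚ K₀ ℂ ⊔ normalClosure ℚ K₁ ℂ) = ⊥) (κ : Fin N → Fin 3) :
    HodgeConjectureFor (⨁ fun j => (![T₀, T₁, E'] : Fin 3 → AbelianVariety ℂ) (κ j)).dim (⨁ fun j => (![T₀, T₁, E'] : Fin 3 → AbelianVariety ℂ) (κ j)).X :=
  hodgeConjectureFor_biproduct_comp_vec_of_two_simple_dim_le_three_foreignCurve_of_markman hW4 h2 hT₀ hT₁ hE hS₀ hS₁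
    (by rw [AndreProductForm.dim_eq_of_isCMTypeRealisation hT₀, h6₀]) (by rw [AndreProductForm.dim_eq_of_isCMTypeRealisation hT₁, h6₁]) hfor κ

end Foreign

end Summit.HodgeConjecture.CorCM.MultiFieldWeil

end
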